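import Summits.Ventures.PercRepro.S1DisjointSumSixThree

/-!
# PercRepro — THE PROFILE OF A SIMPLE RANK-4 MATROID ON 6 POINTS, AND SUBSET COUNTS BY SIZE (p2, gen 28;
SUBCLAIM-S1 §6.10 (xvii)(j) — the `N`-side of the `(5, 4)` split)

What the `(5, 4)`-split consumer (`S1DisjointSumFiveFour`) needs of the corank-2 part `N` (rank `4` on `6` points,
every pair of distinct points of rank `2`): `N_N(a, 1) ≤ |E|`, `N_N(a, b) ≤ C(|E|, a)` when `|E| = a + b`, and the
three `Y`-sums `f(0) + f(1) + f(2) + f(3) ≥ 42` (the sets with `≤ 3` points), `f(1) + … + f(4) ≥ 63` (the nonempty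
sets), `f(2) + f(3) + f(4) ≥ 57` (the sets with `≥ 2` points) — with the general subset counts
`2^n − 1`, `2^n − 1 − n` and `Σ_{k ≤ 3} C(6, k) = 42`, and `Φ(5, 2) = 10/3`. Nothing is claimed about any cell.

* `ncard_setOf_subset_one_le_ncard`, `ncard_setOf_subset_two_le_ncard`, `ncard_setOf_subset_ncard_le_three`;
* `phiK_five_two`;
* `ncard_profileSet_top_one_le_of_pairs'`, `ncard_profileSet_le_choose_of_ncard_eq`;
* `ncard_rankSet_sum_ge_of_pairs_zero_three`, `…_one_four`, `…_two_four`.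
Axioms: standard.
-/

open scoped Matroid

namespace PercRepro

namespace S1

open Set

variable {α : Type}

/-- The nonempty subsets of a finite set `E` number `2^|E| − 1`. -/
theorem ncard_setOf_subset_one_le_ncard {E : Set α} (hE : E.Finite) :
    {A : Set α | A ⊆ E ∧ 1 ≤ A.ncard}.ncard = 2 ^ E.ncard - 1 := by
  have heq : {A : Set α | A ⊆ E ∧ 1 ≤ A.ncard} = 𝒫 E \ {∅} := by
    ext A
    simp only [mem_setOf_eq, mem_sdiff, mem_powerset_iff, mem_singleton_iff]
    constructor
    · rintro ⟨hAE, h1⟩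
      refine ⟨hAE, ?_⟩
      rintro rfl
      rw [ncard_empty] at h1
      omega
    · rintro ⟨hAE, hne⟩
      refine ⟨hAE, ?_⟩
      have hpos := (ncard_pos (hE.subset hAE)).mpr (nonempty_iff_ne_empty.mpr hne)
      omega
  rw [heq, ncard_sdiff_singleton_of_mem (by rw [mem_powerset_iff]; exact empty_subset E),
    ncard_powerset E hE]

/-- The subsets of a finite set `E` with at least two points number `2^|E| − 1 − |E|`. -/
theorem ncard_setOf_subset_two_le_ncard {E : Set α} (hE : E.Finite) :
    {A : Set α | A ⊆ E ∧ 2 ≤ A.ncard}.ncard = 2 ^ E.ncard - 1 - E.ncard := by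
  have heq : {A : Set α | A ⊆ E ∧ 2 ≤ A.ncard} =
      {A : Set α | A ⊆ E ∧ 1 ≤ A.ncard} \ {A : Set α | A ⊆ E ∧ A.ncard = 1} := by
    ext A
    simp only [mem_setOf_eq, mem_sdiff, not_and]
    constructor
    · rintro ⟨hAE, h2⟩
      exact ⟨⟨hAE, by omega⟩, fun _ h1 => by omega⟩
    · rintro ⟨⟨hAE, h1⟩, hn1⟩
      refine ⟨hAE, ?_⟩
      have := hn1 hAE
      omega
  have hsub1 : {A : Set α | A ⊆ E ∧ A.ncard = 1} ⊆ {A : Set α | A ⊆ E ∧ 1 ≤ A.ncard} :=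
    fun A hA => ⟨hA.1, by rw [hA.2]⟩
  rw [heq, ncard_sdiff' hsub1 (hE.finite_subsets.subset (fun _ hA => hA.1)),
    ncard_setOf_subset_one_le_ncard hE, ncard_setOf_subset_ncard_eq hE 1, Nat.choose_one_right]

/-- The subsets of a `6`-point set with at most `3` points number `42`. -/
theorem ncard_setOf_subset_ncard_le_three {E : Set α} (hE : E.Finite) (h6 : E.ncard = 6) :
    {A : Set α | A ⊆ E ∧ A.ncard ≤ 3}.ncard = 42 := by
  have hfin : ∀ k : ℕ, {A : Set α | A ⊆ E ∧ A.ncard = k}.Finite := fun k =>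
    hE.finite_subsets.subset (fun _ hA => hA.1)
  have hcard : ∀ k : ℕ, {A : Set α | A ⊆ E ∧ A.ncard = k}.ncard = Nat.choose 6 k := fun k => by
    rw [ncard_setOf_subset_ncard_eq hE k, h6]
  have hdisj : ∀ k l : ℕ, k ≠ l →
      Disjoint {A : Set α | A ⊆ E ∧ A.ncard = k} {A : Set α | A ⊆ E ∧ A.ncard = l} := by
    intro k l hkl
    rw [Set.disjoint_left]
    rintro A ⟨-, hk⟩ ⟨-, hl⟩
    exact hkl (hk.symm.trans hl)
  have heq : {A : Set α | A ⊆ E ∧ A.ncard ≤ 3} =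
      {A : Set α | A ⊆ E ∧ A.ncard = 0} ∪ {A : Set α | A ⊆ E ∧ A.ncard = 1} ∪
        {A : Set α | A ⊆ E ∧ A.ncard = 2} ∪ {A : Set α | A ⊆ E ∧ A.ncard = 3} := by
    ext A
    simp only [mem_setOf_eq, mem_union]
    constructor
    · rintro ⟨hAE, h3⟩
      rcases Nat.lt_or_ge A.ncard 2 with h | h
      · rcases Nat.lt_or_ge A.ncard 1 with h' | h'
        · exact Or.inl (Or.inl (Or.inl ⟨hAE, by omega⟩))
        · exact Or.inl (Or.inl (Or.inr ⟨hAE, by omega⟩))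
      · rcases Nat.lt_or_ge A.ncard 3 with h' | h'
        · exact Or.inl (Or.inr ⟨hAE, by omega⟩)
        · exact Or.inr ⟨hAE, by omega⟩
    · rintro (((⟨hAE, h⟩ | ⟨hAE, h⟩) | ⟨hAE, h⟩) | ⟨hAE, h⟩) <;> exact ⟨hAE, by omega⟩
  rw [heq, ncard_union_eq (Set.disjoint_union_left.mpr ⟨Set.disjoint_union_left.mpr
      ⟨hdisj 0 3 (by norm_num), hdisj 1 3 (by norm_num)⟩, hdisj 2 3 (by norm_num)⟩)
      (((hfin 0).union (hfin 1)).union (hfin 2)) (hfin 3),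
    ncard_union_eq (Set.disjoint_union_left.mpr ⟨hdisj 0 2 (by norm_num), hdisj 1 2 (by norm_num)⟩)
      ((hfin 0).union (hfin 1)) (hfin 2),
    ncard_union_eq (hdisj 0 1 (by norm_num)) (hfin 0) (hfin 1), hcard 0, hcard 1, hcard 2, hcard 3]
  decide

/-- `Φ(5, 2) = 10/3`. -/
theorem phiK_five_two : phiK 5 2 = 10 / 3 := by
  unfold phiK
  rw [show Finset.Ioo 2 5 = {3, 4} from by decide, show (5 : ℕ) + 2 = 7 from rfl]
  rw [Finset.sum_insert (by decide), Finset.sum_singleton]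
  rw [show Nat.choose 7 3 = 35 by decide, show Nat.choose 7 4 = 35 by decide,
    show Nat.choose 7 5 = 21 by decide]
  norm_num

section PairsRankTwo

variable {N : Matroid α} [N.Finite]

/-- `N_N(a, 1) ≤ |E|` at any rank `a`: a complement of rank `1` is a single point when all pairs have rank `2`. -/
theorem ncard_profileSet_top_one_le_of_pairs' (hpairs : ∀ e ∈ N.E, ∀ f ∈ N.E, e ≠ f → N.eRk {e, f} = 2)
    (a : ℕ) : (profileSet N a 1).ncard ≤ N.E.ncard := by
  have hsub : profileSet N a 1 ⊆ (fun x => N.E \ {x}) '' N.E := by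
    rintro A ⟨hAE, -, hAc⟩
    have hne : (N.E \ A).Nonempty := by
      rw [nonempty_iff_ne_empty]
      rintro h0
      rw [h0, N.eRk_empty] at hAc
      exact absurd hAc (by decide)
    obtain ⟨x, hx⟩ := hne
    refine ⟨x, hx.1, ?_⟩
    show N.E \ {x} = A
    ext y
    constructor
    · rintro ⟨hyE, hyx⟩
      by_contra hyA
      have hxy : x ≠ y := fun h => hyx (by rw [mem_singleton_iff]; exact h.symm)
      have hp := hpairs x hx.1 y hyE hxy
      have hle := N.eRk_mono (show ({x, y} : Set α) ⊆ N.E \ A from by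
        intro z hz
        rcases hz with rfl | rfl
        · exact hx
        · exact ⟨hyE, hyA⟩)
      rw [hp, hAc] at hle
      exact absurd hle (by decide)
    · intro hyA
      exact ⟨hAE hyA, fun hyx => hx.2 (by rw [mem_singleton_iff] at hyx; rw [← hyx]; exact hyA)⟩
  exact (ncard_le_ncard hsub (N.ground_finite.image _)).trans (ncard_image_le N.ground_finite)

/-- `N_N(a, b) ≤ C(|E|, a)` when `|E| = a + b`: such a set has exactly `a` points. -/
theorem ncard_profileSet_le_choose_of_ncard_eq {a b : ℕ} (hE : N.E.ncard = a + b) :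
    (profileSet N a b).ncard ≤ Nat.choose (a + b) a := by
  have hsub : profileSet N a b ⊆ {A : Set α | A ⊆ N.E ∧ A.ncard = a} := by
    rintro A ⟨hAE, hAa, hAc⟩
    refine ⟨hAE, ?_⟩
    have hAfin : A.Finite := N.ground_finite.subset hAE
    have h1 : (a : ℕ∞) ≤ (A.ncard : ℕ∞) := by
      rw [← hAa, hAfin.cast_ncard_eq]; exact N.eRk_le_encard A
    have h2 : (b : ℕ∞) ≤ ((N.E \ A).ncard : ℕ∞) := by
      rw [← hAc, (N.ground_finite.subset sdiff_subset).cast_ncard_eq]; exact N.eRk_le_encard _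
    have h3 : A.ncard + (N.E \ A).ncard = N.E.ncard := by
      rw [← ncard_union_eq disjoint_sdiff_right hAfin (N.ground_finite.subset sdiff_subset),
        union_sdiff_cancel hAE]
    have h1' : a ≤ A.ncard := by exact_mod_cast h1
    have h2' : b ≤ (N.E \ A).ncard := by exact_mod_cast h2
    omega
  have h := ncard_le_ncard hsub (N.ground_finite.finite_subsets.subset (fun _ hA => hA.1))
  rwa [ncard_setOf_subset_ncard_eq N.ground_finite a, hE] at h

/-- Every set with at most `k` points has rank at most `k`; with `N` of rank `4` on `6` points with all pairs of
rank `2`: the sets with `≤ 3` points lie in the rank levels `0 … 3`, so `f(0) + f(1) + f(2) + f(3) ≥ 42`. -/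
theorem ncard_rankSet_sum_ge_of_pairs_zero_three (hE : N.E.ncard = 6) :
    42 ≤ (rankSet N 0).ncard + (rankSet N 1).ncard + (rankSet N 2).ncard + (rankSet N 3).ncard := by
  have hsub : {A : Set α | A ⊆ N.E ∧ A.ncard ≤ 3} ⊆
      rankSet N 0 ∪ rankSet N 1 ∪ rankSet N 2 ∪ rankSet N 3 := by
    rintro A ⟨hAE, h3⟩
    have hAfin : A.Finite := N.ground_finite.subset hAE
    have hle : N.eRk A ≤ (A.ncard : ℕ∞) := by
      rw [hAfin.cast_ncard_eq]; exact N.eRk_le_encard A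
    obtain ⟨n, hn⟩ := ENat.ne_top_iff_exists.mp (ne_top_of_le_ne_top (by simp) hle)
    rw [← hn] at hle
    have hn' : n ≤ A.ncard := by exact_mod_cast hle
    have hmem : ∀ k, n = k → A ∈ rankSet N k := fun k hk => ⟨hAE, by rw [← hn, hk]⟩
    rcases Nat.lt_or_ge n 2 with h | h
    · rcases Nat.lt_or_ge n 1 with h' | h'
      · exact Or.inl (Or.inl (Or.inl (hmem 0 (by omega))))
      · exact Or.inl (Or.inl (Or.inr (hmem 1 (by omega))))
    · rcases Nat.lt_or_ge n 3 with h' | h'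
      · exact Or.inl (Or.inr (hmem 2 (by omega)))
      · exact Or.inr (hmem 3 (by omega))
  have h := ncard_le_ncard hsub ((((rankSet_finite N 0).union (rankSet_finite N 1)).union
    (rankSet_finite N 2)).union (rankSet_finite N 3))
  rw [ncard_setOf_subset_ncard_le_three N.ground_finite hE,
    ncard_union_eq (Set.disjoint_union_left.mpr ⟨Set.disjoint_union_left.mpr
      ⟨rankSet_disjoint_of_ne N (by norm_num), rankSet_disjoint_of_ne N (by norm_num)⟩,
      rankSet_disjoint_of_ne N (by norm_num)⟩)
      (((rankSet_finite N 0).union (rankSet_finite N 1)).union (rankSet_finite N 2)) (rankSet_finite N 3),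
    ncard_union_eq (Set.disjoint_union_left.mpr
      ⟨rankSet_disjoint_of_ne N (by norm_num), rankSet_disjoint_of_ne N (by norm_num)⟩)
      ((rankSet_finite N 0).union (rankSet_finite N 1)) (rankSet_finite N 2),
    ncard_union_eq (rankSet_disjoint_of_ne N (by norm_num)) (rankSet_finite N 0) (rankSet_finite N 1)] at h
  exact h

/-- The nonempty sets of `N` (rank `4` on `6` points, all pairs of rank `2`) have rank `1 … 4`:
`f(1) + f(2) + f(3) + f(4) ≥ 63`. -/
theorem ncard_rankSet_sum_ge_of_pairs_one_four (hpairs : ∀ e ∈ N.E, ∀ f ∈ N.E, e ≠ f → N.eRk {e, f} = 2)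
    (hN : N.eRank = ((4 : ℕ) : ℕ∞)) (hE : N.E.ncard = 6) :
    63 ≤ (rankSet N 1).ncard + (rankSet N 2).ncard + (rankSet N 3).ncard + (rankSet N 4).ncard := by
  have hsub : {A : Set α | A ⊆ N.E ∧ 1 ≤ A.ncard} ⊆
      rankSet N 1 ∪ rankSet N 2 ∪ rankSet N 3 ∪ rankSet N 4 := by
    rintro A ⟨hAE, h1⟩
    have hAfin : A.Finite := N.ground_finite.subset hAE
    obtain ⟨e, he⟩ := (ncard_pos hAfin).mp (by omega)
    have hlo : 1 ≤ N.eRk A := by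
      rw [← eRk_singleton_eq_one_of_pairs hpairs (by omega) (hAE he)]
      exact N.eRk_mono (singleton_subset_iff.mpr he)
    have hhi := N.eRk_le_eRank A
    rw [hN] at hhi
    obtain ⟨n, hn⟩ := ENat.ne_top_iff_exists.mp (ne_top_of_le_ne_top (by decide) hhi)
    rw [← hn] at hlo hhi
    have hlo' : 1 ≤ n := by exact_mod_cast hlo
    have hhi' : n ≤ 4 := by exact_mod_cast hhi
    have hmem : ∀ k, n = k → A ∈ rankSet N k := fun k hk => ⟨hAE, by rw [← hn, hk]⟩
    rcases Nat.lt_or_ge n 3 with h | h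
    · rcases Nat.lt_or_ge n 2 with h' | h'
      · exact Or.inl (Or.inl (Or.inl (hmem 1 (by omega))))
      · exact Or.inl (Or.inl (Or.inr (hmem 2 (by omega))))
    · rcases Nat.lt_or_ge n 4 with h' | h'
      · exact Or.inl (Or.inr (hmem 3 (by omega)))
      · exact Or.inr (hmem 4 (by omega))
  have h := ncard_le_ncard hsub ((((rankSet_finite N 1).union (rankSet_finite N 2)).union
    (rankSet_finite N 3)).union (rankSet_finite N 4))
  rw [ncard_setOf_subset_one_le_ncard N.ground_finite, hE,
    ncard_union_eq (Set.disjoint_union_left.mpr ⟨Set.disjoint_union_left.mpr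
      ⟨rankSet_disjoint_of_ne N (by norm_num), rankSet_disjoint_of_ne N (by norm_num)⟩,
      rankSet_disjoint_of_ne N (by norm_num)⟩)
      (((rankSet_finite N 1).union (rankSet_finite N 2)).union (rankSet_finite N 3)) (rankSet_finite N 4),
    ncard_union_eq (Set.disjoint_union_left.mpr
      ⟨rankSet_disjoint_of_ne N (by norm_num), rankSet_disjoint_of_ne N (by norm_num)⟩)
      ((rankSet_finite N 1).union (rankSet_finite N 2)) (rankSet_finite N 3),
    ncard_union_eq (rankSet_disjoint_of_ne N (by norm_num)) (rankSet_finite N 1) (rankSet_finite N 2)] at h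
  exact h

/-- The sets of `N` (rank `4` on `6` points, all pairs of rank `2`) with at least two points have rank
`2 … 4`: `f(2) + f(3) + f(4) ≥ 57`. -/
theorem ncard_rankSet_sum_ge_of_pairs_two_four (hpairs : ∀ e ∈ N.E, ∀ f ∈ N.E, e ≠ f → N.eRk {e, f} = 2)
    (hN : N.eRank = ((4 : ℕ) : ℕ∞)) (hE : N.E.ncard = 6) :
    57 ≤ (rankSet N 2).ncard + (rankSet N 3).ncard + (rankSet N 4).ncard := by
  have hsub : {A : Set α | A ⊆ N.E ∧ 2 ≤ A.ncard} ⊆ rankSet N 2 ∪ rankSet N 3 ∪ rankSet N 4 := by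
    rintro A ⟨hAE, h2⟩
    have hlo := two_le_eRk_of_two_le_ncard hpairs hAE h2
    have hhi := N.eRk_le_eRank A
    rw [hN] at hhi
    obtain ⟨n, hn⟩ := ENat.ne_top_iff_exists.mp (ne_top_of_le_ne_top (by decide) hhi)
    rw [← hn] at hlo hhi
    have hlo' : 2 ≤ n := by exact_mod_cast hlo
    have hhi' : n ≤ 4 := by exact_mod_cast hhi
    have hmem : ∀ k, n = k → A ∈ rankSet N k := fun k hk => ⟨hAE, by rw [← hn, hk]⟩
    rcases Nat.lt_or_ge n 3 with h | h
    · exact Or.inl (Or.inl (hmem 2 (by omega)))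
    · rcases Nat.lt_or_ge n 4 with h' | h'
      · exact Or.inl (Or.inr (hmem 3 (by omega)))
      · exact Or.inr (hmem 4 (by omega))
  have h := ncard_le_ncard hsub (((rankSet_finite N 2).union (rankSet_finite N 3)).union (rankSet_finite N 4))
  rw [ncard_setOf_subset_two_le_ncard N.ground_finite, hE,
    ncard_union_eq (Set.disjoint_union_left.mpr
      ⟨rankSet_disjoint_of_ne N (by norm_num), rankSet_disjoint_of_ne N (by norm_num)⟩)
      ((rankSet_finite N 2).union (rankSet_finite N 3)) (rankSet_finite N 4),
    ncard_union_eq (rankSet_disjoint_of_ne N (by norm_num)) (rankSet_finite N 2) (rankSet_finite N 3)] at h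
  exact h

end PairsRankTwo

end S1

end PercRepro
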